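import Literature.AlgebraicGeometry.HodgeTheory.MonomialSupportedLinearPencilLoops
import Literature.AlgebraicGeometry.HodgeTheory.MonomialSupportedHypersurfaceFamilyPoints
import Literature.AlgebraicGeometry.HodgeTheory.HodgeGenericPointsCountableOfGriffithsCurve
import Literature.AlgebraicGeometry.HodgeTheory.GriffithsHolomorphicHodgeSubbundlesQP
import Literature.AlgebraicGeometry.HodgeTheory.AlgebraicMonodromyMumfordTateOfQuasiProjective
import Literature.AlgebraicGeometry.HodgeTheory.HodgeGenericQbarDescentFiniteMonodromyInputs
import Literature.AlgebraicGeometry.HodgeTheory.BettiUniverseIsoTransport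
import Literature.AlgebraicGeometry.Motives.MumfordTateGroupTransport
import Literature.AlgebraicGeometry.Motives.MonomialSupportedFamilyQuasiProjective
import Literature.AlgebraicGeometry.FundamentalGroup.HypersurfaceComplementPencilDiscriminantShift
import HarnessLib

/-!
# Along a transversal pencil of `M`-supported hypersurfaces, off COUNTABLY many members the algebraic monodromy
# group of the whole `M`-supported family lies in the Mumford–Tate group (Deligne 1972 Prop. 7.5 in dimension one,
# granted Griffiths' holomorphy of the Hodge bundles; NO Cattani–Deligne–Kaplan)

Family `hodge`, layer `Literature/AlgebraicGeometry/HodgeTheory`, namespace `…HodgeTheory.MonomialPencil`; one theorem,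
no definition, no new named fact (the print theorem `Griffiths1968_holomorphicHodgeSubbundles` is a HYPOTHESIS).  Written by
the prover seat `hodge-nonav-prover-Ax` (g15, cell `hodge-nonav`) for route `SignSymmetricPowers` (crux K1-B,
stmt-HodgeConjecture-19716), programme PENCIL-B; the route-B twin of the route-A curve theorem
`CyclicUnitaryPowersCurvesOfLargeMonodromyHodgeOffCountable` up to its line `hΓ`, for the family `familyM ℂ n d M` and the
pencils of `MonomialSupportedLinearPencil`.

`identityComponent_le_mumfordTate_offCountable_of_pencil`: let `(f₀, g)` be a pointed line of `M`-coefficient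
vectors transversal to the (reduced) discriminant `h` read through a coefficient chart `χ : S_M(ℂ) ≃ₜ ℂ^M ∖ V(h)`
(`pencilDiscr h ≠ 0`), `A` Hodge-symmetric models of the fibres of `π_M = familyM ℂ n d M`, `k` a degree.  Then there is a
COUNTABLE set `C` of points of the pencil base `P` such that for every `c ∉ C` the identity component `(Γ^Zar)⁰` of the
monodromy group `Γ` of `π_M` at `ι c` (in degree `k`) lies in `MT(Hᵏ(𝒴_{ι c}))`:

* Griffiths ⇒ the non-Hodge-generic points of the pulled-back family `π' = π_M ×_{S_M} P` over the CURVE `P` are countable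
  (`exists_countable_isHodgeGenericPoint_of_griffiths1968_curve`);
* Deligne (i) for `π'` at a generic `c` (`deligne_finiteIndex_monodromy_le_mumfordTateGroup_of_isQuasiProjectiveOver`): a
  finite-index subgroup of `Γ_{π'}(c)` inside `MT`;
* Zariski for the pencil (`MonomialPencil.exists_finiteIndex_pencilMap`): all of `Γ_{π_M}(ι c)` is `e_c`-conjugate to
  monodromies of `π'`; transport of Mumford–Tate groups along `e_c : 𝒴'_c ≅ 𝒴_{ι c}` (`mem_mumfordTateGroup_comapEquiv_iff`,
  `hodge_eq_comapEquiv_of_iso`) ⇒ a finite-index subgroup of `Γ_{π_M}(ι c)` inside `MT`;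
* `glIdentityComponent_subset_of_finiteIndex` + `glZariskiClosure_subset_mumfordTateGroup`.

## References

* [Deligne1972WeilK3] P. Deligne, La conjecture de Weil pour les surfaces K3, Invent. Math. 15 (1972), Prop. 7.5.
* [CarlsonMullerStachPeters2017] J. Carlson, S. Müller-Stach, C. Peters, Period Mappings and Period Domains, 2nd ed.,
  Lemma–Definition 15.3.7.
* [VoisinHodgeI2002] C. Voisin, Hodge Theory and Complex Algebraic Geometry I, §10.2.1 Thm. 10.3.
* [VoisinHodgeII2003] C. Voisin, Hodge Theory and Complex Algebraic Geometry II, §3.2.2 Thm. 3.22, §6.2.1.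
-/

noncomputable section

namespace Literature.AlgebraicGeometry.HodgeTheory

open scoped TensorProduct Topology
open CategoryTheory CategoryTheory.Limits _root_.AlgebraicGeometry MvPolynomial Set
open _root_.Topology _root_.Filter
open Literature.AlgebraicGeometry.Motives Literature.AlgebraicGeometry.Motives.UniversalHypersurface
open Literature.AlgebraicGeometry.HodgeTheory.BettiUniverse Literature.AlgebraicGeometry.HodgeTheory.UniversalHypersurface
open Literature.AlgebraicTopology.SingularHomology
open Literature.AlgebraicGeometry.FundamentalGroup

namespace MonomialPencil

/-- **Deligne's «very general» in dimension one, for a transversal pencil of `M`-supported hypersurfaces** (see the module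
docstring): off a COUNTABLE set of points `c` of the pencil base, `(Γ_{ι c}^Zar)⁰ ⊆ MT(Hᵏ(𝒴_{ι c}))` for the monodromy group
`Γ_{ι c}` of the whole `M`-supported family `familyM ℂ n d M` at `ι c`.  CONDITIONAL on Griffiths' theorem (hypothesis `hGr`).
[cite: Deligne1972WeilK3, Prop. 7.5] [cite: CarlsonMullerStachPeters2017, Lemma–Definition 15.3.7]
[cite: VoisinHodgeII2003, §3.2.2 Thm. 3.22 and §6.2.1] [cite: VoisinHodgeI2002, §10.2.1 Thm. 10.3] -/
theorem identityComponent_le_mumfordTate_offCountable_of_pencil (hGr : Griffiths1968_holomorphicHodgeSubbundles)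
    [HodgeTensorFacts.{0, 0}] {n d : ℕ} (hd : 1 ≤ d) (M : Set (DegIndex n d)) [DecidablePred (· ∈ M)] (k : ℕ)
    (hu : IsSmoothProjectiveFamily (familyM ℂ n d M) n)
    (hU : IsCohomologicallyLocallyTrivialOn (familyM ℂ n d M) (univ : Set (ComplexPoints (baseM ℂ n d M))))
    (A : ∀ t : ComplexPoints (baseM ℂ n d M), HodgeModel n (fiberOver (familyM ℂ n d M) t)) (hA : ∀ t, (A t).IsHodgeSymmetric)
    {h : MvPolynomial M ℂ} (χ : ComplexPoints (baseM ℂ n d M) ≃ₜ affineHypersurfaceComplement ![h])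
    (hχ : ∀ (t : ComplexPoints (baseM ℂ n d M)) (m : M), (χ t : M → ℂ) m = coeff m.1.1 (pointFormM ℂ n d M t))
    {f₀ g : M → ℂ} (hg : g ≠ 0) (hQ : MvPolynomial.eval (Sum.elim f₀ g) (pencilDiscr h) ≠ 0) :
    ∃ C : Set (ComplexPoints (pencilBase n d M f₀ g)), C.Countable ∧
      ∀ c : ComplexPoints (pencilBase n d M f₀ g), c ∉ C →
        haveI := finite (hu.isSmoothProjective (AlgPoints.map (pencilMap n d M f₀ g) c)) k
        glIdentityComponent (ratMonodromyGroup (familyM ℂ n d M) k hU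
            ⟨AlgPoints.map (pencilMap n d M f₀ g) c, mem_univ _⟩) ⊆
          (((A (AlgPoints.map (pencilMap n d M f₀ g) c)).hodgeStructure
              (hu.isSmoothProjective _) (hA _) k).mumfordTateGroup :
            Set (bettiCohomology (fiberOver (familyM ℂ n d M)
                (AlgPoints.map (pencilMap n d M f₀ g) c)) k ≃ₗ[ℚ]
              bettiCohomology (fiberOver (familyM ℂ n d M)
                (AlgPoints.map (pencilMap n d M f₀ g) c)) k)) := by
  classical
  -- ### the pencil `ι : P ⟶ S_M`
  let ι := pencilMap n d M f₀ g
  have hPq : IsQuasiProjectiveOver (pencilBase n d M f₀ g) := isQuasiProjectiveOver_baseSpz n d _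
  haveI : SmoothOfRelativeDimension 1 (pencilBase n d M f₀ g).hom := by
    have h1 := smoothOfRelativeDimension_baseSpz_hom ℂ n d (pencilCompSpz n d M f₀ g)
    rwa [Nat.card_eq_fintype_card, Fintype.card_fin, zero_add] at h1
  haveI hPs : Smooth (pencilBase n d M f₀ g).hom := smooth_baseSpz_hom ℂ n d _
  -- the base point `u = 0`: the `M`-coefficient vector of `F₀` lies in `ℂ^M ∖ V(h)`, hence is the chart of a point of `S_M(ℂ)`
  have hf₀U : f₀ ∈ affineHypersurfaceComplement ![h] := mem_affineHypersurfaceComplement_of_pencilDiscr hQ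
  obtain ⟨c₁, -, -⟩ := exists_pencilCoord_eq_of_coeff n d M f₀ g (χ.symm ⟨_, hf₀U⟩) 0
    (fun m => by rw [← hχ, Homeomorph.apply_symm_apply, zero_mul, add_zero])
  haveI : IrreducibleSpace (pencilBase n d M f₀ g).left :=
    irreducibleSpace_baseSpz_left ℂ n d _ ⟨c₁.pt⟩
  -- ### the two families
  haveI : IsSeparated (baseM ℂ n d M).hom := isSeparated_baseM_hom ℂ n d M
  have hf' : IsSmoothProjectiveFamily (familyPullback.snd (familyM ℂ n d M) ι) n := hu.familyPullback_snd ι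
  have hU' := isCohomologicallyLocallyTrivialOn_univ_of_isQuasiProjectiveOver (familyPullback.snd (familyM ℂ n d M) ι) hf' hPq
    inferInstance
  haveI : ∀ t : ComplexPoints (baseM ℂ n d M), Module.Finite ℚ (bettiCohomology (fiberOver (familyM ℂ n d M) t) k) :=
    fun t => finite (hu.isSmoothProjective t) k
  haveI : ∀ c : ComplexPoints (pencilBase n d M f₀ g),
      Module.Finite ℚ (bettiCohomology (fiberOver (familyPullback.snd (familyM ℂ n d M) ι) c) k) :=
    fun c => finite (hf'.isSmoothProjective c) k
  -- real (hence Hodge-symmetric) Hodge models of the fibres of the pulled-back family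
  have hAm' := fun c : ComplexPoints (pencilBase n d M f₀ g) =>
    exists_isReal_hodgeModel_holds.exists_isHodgeSymmetric (hf'.isSmoothProjective c)
  let A' : ∀ c : ComplexPoints (pencilBase n d M f₀ g),
      HodgeModel n (fiberOver (familyPullback.snd (familyM ℂ n d M) ι) c) := fun c => (hAm' c).choose
  have hA' : ∀ c, (A' c).IsHodgeSymmetric := fun c => (hAm' c).choose_spec
  -- ### Griffiths: the non-Hodge-generic points of the curve are countable
  obtain ⟨C, hCc, hgen⟩ := exists_countable_isHodgeGenericPoint_of_griffiths1968_curve hGr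
    (familyPullback.snd (familyM ℂ n d M) ι) n k hf' hPq hU' A' hA'
  refine ⟨C, hCc, fun c hc => ?_⟩
  -- ### Deligne (i) for the curve family at `c`
  have hgenc := hgen ⟨c, mem_univ _⟩ hc
  obtain ⟨Γ'', hΓ''le, hΓ''fi, hΓ''MT⟩ :=
    (deligne_finiteIndex_monodromy_le_mumfordTateGroup_of_isQuasiProjectiveOver
      (familyPullback.snd (familyM ℂ n d M) ι) n k hf'
      (isQuasiProjectiveOver_familyPullback_of_isSeparated (familyM ℂ n d M) ι
        (isQuasiProjectiveOver_totalM ℂ n d M (by omega)) hPq)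
      hPq hPs inferInstance hU' A' hA' ⟨c, mem_univ _⟩ hgenc).1
  -- ### Zariski for the pencil: (HL) at `c`
  have hQc : MvPolynomial.eval (Sum.elim (f₀ + pencilCoord n d M f₀ g c • g)
      g) (pencilDiscr h) ≠ 0 := by
    refine eval_pencilDiscr_ne_zero_of_shift hQ _ fun h0 => ?_
    have hmem := (χ (AlgPoints.map ι c)).2
    rw [mem_affineHypersurfaceComplement_iff] at hmem
    refine hmem 0 ?_
    have heq : ((χ (AlgPoints.map ι c) : M → ℂ)) =
        f₀ + pencilCoord n d M f₀ g c • g := by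
      funext m
      rw [hχ, coeff_pointFormM_map_pencilMap_of_mem n d M _ _ c m.2]
      rfl
    change MvPolynomial.eval ((χ (AlgPoints.map ι c) : M → ℂ)) (![h] 0) = 0
    rw [heq]
    exact h0
  obtain ⟨Γ₀, hΓ₀le, hΓ₀fi, hΓ₀mon⟩ := exists_finiteIndex_pencilMap χ hχ hg k hU hU' c hQc
  -- ### transfer to the fibre of `π_M` over `ι c`
  let eC := fiberOverFamilyPullbackIso (familyM ℂ n d M) ι c
  let E : bettiCohomology (fiberOver (familyPullback.snd (familyM ℂ n d M) ι) c) k ≃ₗ[ℚ]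
      bettiCohomology (fiberOver (familyM ℂ n d M) (AlgPoints.map ι c)) k := pullEquiv eC k
  let conj : (bettiCohomology (fiberOver (familyM ℂ n d M) (AlgPoints.map ι c)) k ≃ₗ[ℚ]
      bettiCohomology (fiberOver (familyM ℂ n d M) (AlgPoints.map ι c)) k) →*
      (bettiCohomology (fiberOver (familyPullback.snd (familyM ℂ n d M) ι) c) k ≃ₗ[ℚ]
        bettiCohomology (fiberOver (familyPullback.snd (familyM ℂ n d M) ι) c) k) :=
    { toFun := fun T => E.trans (T.trans E.symm)
      map_one' := by
        ext v
        simp [LinearEquiv.one_eq_refl]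
      map_mul' := fun T₁ T₂ => by
        ext v
        simp [LinearEquiv.mul_eq_trans] }
  have hconj : ∀ T, conj T = E.trans (T.trans E.symm) := fun _ => rfl
  let Γ' : Subgroup (bettiCohomology (fiberOver (familyM ℂ n d M) (AlgPoints.map ι c)) k ≃ₗ[ℚ]
      bettiCohomology (fiberOver (familyM ℂ n d M) (AlgPoints.map ι c)) k) := Γ₀ ⊓ Γ''.comap conj
  have hΓ'le : Γ' ≤ ratMonodromyGroup (familyM ℂ n d M) k hU ⟨AlgPoints.map ι c, mem_univ _⟩ :=
    fun T hT => hΓ₀le (Subgroup.mem_inf.1 hT).1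
  have hΓ'fi : (Γ'.subgroupOf (ratMonodromyGroup (familyM ℂ n d M) k hU ⟨AlgPoints.map ι c, mem_univ _⟩)).FiniteIndex := by
    have hmaple : Γ₀.map conj ≤ ratMonodromyGroup (familyPullback.snd (familyM ℂ n d M) ι) k hU' ⟨c, mem_univ _⟩ := by
      rintro _ ⟨T, hT, rfl⟩
      exact hΓ₀mon T hT
    have h1 : Γ''.relIndex (Γ₀.map conj) ≠ 0 := fun h0 =>
      hΓ''fi.index_ne_zero (Subgroup.relIndex_eq_zero_of_le_right hmaple h0)
    have h2 : (Γ''.comap conj).relIndex Γ₀ ≠ 0 := by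
      rwa [Subgroup.relIndex_comap]
    have h3 : Γ'.relIndex Γ₀ ≠ 0 := by
      change (Γ₀ ⊓ Γ''.comap conj).relIndex Γ₀ ≠ 0
      rwa [Subgroup.inf_relIndex_left]
    have h4 : Γ₀.relIndex (ratMonodromyGroup (familyM ℂ n d M) k hU ⟨AlgPoints.map ι c, mem_univ _⟩) ≠ 0 := hΓ₀fi.index_ne_zero
    refine ⟨?_⟩
    change Γ'.relIndex _ ≠ 0
    rw [← Subgroup.relIndex_mul_relIndex Γ' Γ₀ (ratMonodromyGroup (familyM ℂ n d M) k hU ⟨AlgPoints.map ι c, mem_univ _⟩)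
      inf_le_left hΓ₀le]
    exact mul_ne_zero h3 h4
  have hHS' : (A' c).hodgeStructure (hf'.isSmoothProjective c) (hA' c) k =
      ((A (AlgPoints.map ι c)).hodgeStructure (hu.isSmoothProjective (AlgPoints.map ι c)) (hA (AlgPoints.map ι c)) k).comapEquiv E := by
    rw [HodgeModel.hodgeStructure_eq_hodge exists_isReal_hodgeModel_holds hodgePQ_independent_of_hodgeModel_holds
        (hf'.isSmoothProjective c) (A' c) (hA' c) k,
      HodgeModel.hodgeStructure_eq_hodge exists_isReal_hodgeModel_holds hodgePQ_independent_of_hodgeModel_holds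
        (hu.isSmoothProjective (AlgPoints.map ι c)) (A (AlgPoints.map ι c)) (hA (AlgPoints.map ι c)) k]
    exact hodge_eq_comapEquiv_of_iso exists_isReal_hodgeModel_holds hodgePQ_independent_of_hodgeModel_holds
      (hf'.isSmoothProjective c) (hu.isSmoothProjective (AlgPoints.map ι c)) eC k
  have hΓ'MT : Γ' ≤ ((A (AlgPoints.map ι c)).hodgeStructure (hu.isSmoothProjective (AlgPoints.map ι c))
      (hA (AlgPoints.map ι c)) k).mumfordTateGroup := by
    intro T hT
    have h1 := hΓ''MT (Subgroup.mem_inf.1 hT).2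
    change conj T ∈ ((A' c).hodgeStructure (hf'.isSmoothProjective c) (hA' c) k).mumfordTateGroup at h1
    rw [hconj, hHS', HodgeStructure.mem_mumfordTateGroup_comapEquiv_iff] at h1
    have hid : E.symm.trans ((E.trans (T.trans E.symm)).trans E) = T := by
      ext v
      simp
    rwa [hid] at h1
  -- ### `(Γ^Zar)⁰ ⊆ (Γ')^Zar ⊆ MT`
  exact (glIdentityComponent_subset_of_finiteIndex hΓ'le hΓ'fi).trans (glZariskiClosure_subset_mumfordTateGroup _ hΓ'MT)

/-- **The same, granted only the QUASI-PROJECTIVE form of Griffiths' theorem** (`Griffiths1968_holomorphicHodgeSubbundlesQP`, the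
twin with total space quasi-projective — which the pulled-back pencil family is: `isQuasiProjectiveOver_familyPullback_of_isSeparated` +
`isQuasiProjectiveOver_totalM`): off a COUNTABLE set of points `c` of the pencil base, `(Γ_{ι c}^Zar)⁰ ⊆ MT(Hᵏ(𝒴_{ι c}))`.  Same proof,
the one Griffiths application swapped for `exists_countable_isHodgeGenericPoint_of_griffiths1968QP_curve`.  CONDITIONAL on the QP fact
(weaker hypothesis: `griffiths1968QP_of_griffiths1968`).
[cite: Deligne1972WeilK3, Prop. 7.5] [cite: CarlsonMullerStachPeters2017, Lemma–Definition 15.3.7]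
[cite: VoisinHodgeII2003, §3.2.2 Thm. 3.22 and §6.2.1] [cite: VoisinHodgeI2002, §10.2.1 Thm. 10.3] -/
theorem identityComponent_le_mumfordTate_offCountable_of_pencil_QP (hGr : Griffiths1968_holomorphicHodgeSubbundlesQP)
    [HodgeTensorFacts.{0, 0}] {n d : ℕ} (hd : 1 ≤ d) (M : Set (DegIndex n d)) [DecidablePred (· ∈ M)] (k : ℕ)
    (hu : IsSmoothProjectiveFamily (familyM ℂ n d M) n)
    (hU : IsCohomologicallyLocallyTrivialOn (familyM ℂ n d M) (univ : Set (ComplexPoints (baseM ℂ n d M))))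
    (A : ∀ t : ComplexPoints (baseM ℂ n d M), HodgeModel n (fiberOver (familyM ℂ n d M) t)) (hA : ∀ t, (A t).IsHodgeSymmetric)
    {h : MvPolynomial M ℂ} (χ : ComplexPoints (baseM ℂ n d M) ≃ₜ affineHypersurfaceComplement ![h])
    (hχ : ∀ (t : ComplexPoints (baseM ℂ n d M)) (m : M), (χ t : M → ℂ) m = coeff m.1.1 (pointFormM ℂ n d M t))
    {f₀ g : M → ℂ} (hg : g ≠ 0) (hQ : MvPolynomial.eval (Sum.elim f₀ g) (pencilDiscr h) ≠ 0) :
    ∃ C : Set (ComplexPoints (pencilBase n d M f₀ g)), C.Countable ∧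
      ∀ c : ComplexPoints (pencilBase n d M f₀ g), c ∉ C →
        haveI := finite (hu.isSmoothProjective (AlgPoints.map (pencilMap n d M f₀ g) c)) k
        glIdentityComponent (ratMonodromyGroup (familyM ℂ n d M) k hU
            ⟨AlgPoints.map (pencilMap n d M f₀ g) c, mem_univ _⟩) ⊆
          (((A (AlgPoints.map (pencilMap n d M f₀ g) c)).hodgeStructure
              (hu.isSmoothProjective _) (hA _) k).mumfordTateGroup :
            Set (bettiCohomology (fiberOver (familyM ℂ n d M)
                (AlgPoints.map (pencilMap n d M f₀ g) c)) k ≃ₗ[ℚ]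
              bettiCohomology (fiberOver (familyM ℂ n d M)
                (AlgPoints.map (pencilMap n d M f₀ g) c)) k)) := by
  classical
  -- ### the pencil `ι : P ⟶ S_M`
  let ι := pencilMap n d M f₀ g
  have hPq : IsQuasiProjectiveOver (pencilBase n d M f₀ g) := isQuasiProjectiveOver_baseSpz n d _
  haveI : SmoothOfRelativeDimension 1 (pencilBase n d M f₀ g).hom := by
    have h1 := smoothOfRelativeDimension_baseSpz_hom ℂ n d (pencilCompSpz n d M f₀ g)
    rwa [Nat.card_eq_fintype_card, Fintype.card_fin, zero_add] at h1
  haveI hPs : Smooth (pencilBase n d M f₀ g).hom := smooth_baseSpz_hom ℂ n d _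
  -- the base point `u = 0`: the `M`-coefficient vector of `F₀` lies in `ℂ^M ∖ V(h)`, hence is the chart of a point of `S_M(ℂ)`
  have hf₀U : f₀ ∈ affineHypersurfaceComplement ![h] := mem_affineHypersurfaceComplement_of_pencilDiscr hQ
  obtain ⟨c₁, -, -⟩ := exists_pencilCoord_eq_of_coeff n d M f₀ g (χ.symm ⟨_, hf₀U⟩) 0
    (fun m => by rw [← hχ, Homeomorph.apply_symm_apply, zero_mul, add_zero])
  haveI : IrreducibleSpace (pencilBase n d M f₀ g).left :=
    irreducibleSpace_baseSpz_left ℂ n d _ ⟨c₁.pt⟩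
  -- ### the two families
  haveI : IsSeparated (baseM ℂ n d M).hom := isSeparated_baseM_hom ℂ n d M
  have hf' : IsSmoothProjectiveFamily (familyPullback.snd (familyM ℂ n d M) ι) n := hu.familyPullback_snd ι
  have hU' := isCohomologicallyLocallyTrivialOn_univ_of_isQuasiProjectiveOver (familyPullback.snd (familyM ℂ n d M) ι) hf' hPq
    inferInstance
  haveI : ∀ t : ComplexPoints (baseM ℂ n d M), Module.Finite ℚ (bettiCohomology (fiberOver (familyM ℂ n d M) t) k) :=
    fun t => finite (hu.isSmoothProjective t) k
  haveI : ∀ c : ComplexPoints (pencilBase n d M f₀ g),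
      Module.Finite ℚ (bettiCohomology (fiberOver (familyPullback.snd (familyM ℂ n d M) ι) c) k) :=
    fun c => finite (hf'.isSmoothProjective c) k
  -- real (hence Hodge-symmetric) Hodge models of the fibres of the pulled-back family
  have hAm' := fun c : ComplexPoints (pencilBase n d M f₀ g) =>
    exists_isReal_hodgeModel_holds.exists_isHodgeSymmetric (hf'.isSmoothProjective c)
  let A' : ∀ c : ComplexPoints (pencilBase n d M f₀ g),
      HodgeModel n (fiberOver (familyPullback.snd (familyM ℂ n d M) ι) c) := fun c => (hAm' c).choose
  have hA' : ∀ c, (A' c).IsHodgeSymmetric := fun c => (hAm' c).choose_spec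
  -- ### Griffiths: the non-Hodge-generic points of the curve are countable
  have h𝒳' : IsQuasiProjectiveOver (familyPullback (familyM ℂ n d M) ι) :=
    isQuasiProjectiveOver_familyPullback_of_isSeparated (familyM ℂ n d M) ι (isQuasiProjectiveOver_totalM ℂ n d M (by omega)) hPq
  obtain ⟨C, hCc, hgen⟩ := exists_countable_isHodgeGenericPoint_of_griffiths1968QP_curve hGr
    (familyPullback.snd (familyM ℂ n d M) ι) n k hf' hPq h𝒳' hU' A' hA'
  refine ⟨C, hCc, fun c hc => ?_⟩
  -- ### Deligne (i) for the curve family at `c`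
  have hgenc := hgen ⟨c, mem_univ _⟩ hc
  obtain ⟨Γ'', hΓ''le, hΓ''fi, hΓ''MT⟩ :=
    (deligne_finiteIndex_monodromy_le_mumfordTateGroup_of_isQuasiProjectiveOver
      (familyPullback.snd (familyM ℂ n d M) ι) n k hf'
      (isQuasiProjectiveOver_familyPullback_of_isSeparated (familyM ℂ n d M) ι
        (isQuasiProjectiveOver_totalM ℂ n d M (by omega)) hPq)
      hPq hPs inferInstance hU' A' hA' ⟨c, mem_univ _⟩ hgenc).1
  -- ### Zariski for the pencil: (HL) at `c`
  have hQc : MvPolynomial.eval (Sum.elim (f₀ + pencilCoord n d M f₀ g c • g)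
      g) (pencilDiscr h) ≠ 0 := by
    refine eval_pencilDiscr_ne_zero_of_shift hQ _ fun h0 => ?_
    have hmem := (χ (AlgPoints.map ι c)).2
    rw [mem_affineHypersurfaceComplement_iff] at hmem
    refine hmem 0 ?_
    have heq : ((χ (AlgPoints.map ι c) : M → ℂ)) =
        f₀ + pencilCoord n d M f₀ g c • g := by
      funext m
      rw [hχ, coeff_pointFormM_map_pencilMap_of_mem n d M _ _ c m.2]
      rfl
    change MvPolynomial.eval ((χ (AlgPoints.map ι c) : M → ℂ)) (![h] 0) = 0
    rw [heq]
    exact h0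
  obtain ⟨Γ₀, hΓ₀le, hΓ₀fi, hΓ₀mon⟩ := exists_finiteIndex_pencilMap χ hχ hg k hU hU' c hQc
  -- ### transfer to the fibre of `π_M` over `ι c`
  let eC := fiberOverFamilyPullbackIso (familyM ℂ n d M) ι c
  let E : bettiCohomology (fiberOver (familyPullback.snd (familyM ℂ n d M) ι) c) k ≃ₗ[ℚ]
      bettiCohomology (fiberOver (familyM ℂ n d M) (AlgPoints.map ι c)) k := pullEquiv eC k
  let conj : (bettiCohomology (fiberOver (familyM ℂ n d M) (AlgPoints.map ι c)) k ≃ₗ[ℚ]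
      bettiCohomology (fiberOver (familyM ℂ n d M) (AlgPoints.map ι c)) k) →*
      (bettiCohomology (fiberOver (familyPullback.snd (familyM ℂ n d M) ι) c) k ≃ₗ[ℚ]
        bettiCohomology (fiberOver (familyPullback.snd (familyM ℂ n d M) ι) c) k) :=
    { toFun := fun T => E.trans (T.trans E.symm)
      map_one' := by
        ext v
        simp [LinearEquiv.one_eq_refl]
      map_mul' := fun T₁ T₂ => by
        ext v
        simp [LinearEquiv.mul_eq_trans] }
  have hconj : ∀ T, conj T = E.trans (T.trans E.symm) := fun _ => rfl
  let Γ' : Subgroup (bettiCohomology (fiberOver (familyM ℂ n d M) (AlgPoints.map ι c)) k ≃ₗ[ℚ]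
      bettiCohomology (fiberOver (familyM ℂ n d M) (AlgPoints.map ι c)) k) := Γ₀ ⊓ Γ''.comap conj
  have hΓ'le : Γ' ≤ ratMonodromyGroup (familyM ℂ n d M) k hU ⟨AlgPoints.map ι c, mem_univ _⟩ :=
    fun T hT => hΓ₀le (Subgroup.mem_inf.1 hT).1
  have hΓ'fi : (Γ'.subgroupOf (ratMonodromyGroup (familyM ℂ n d M) k hU ⟨AlgPoints.map ι c, mem_univ _⟩)).FiniteIndex := by
    have hmaple : Γ₀.map conj ≤ ratMonodromyGroup (familyPullback.snd (familyM ℂ n d M) ι) k hU' ⟨c, mem_univ _⟩ := by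
      rintro _ ⟨T, hT, rfl⟩
      exact hΓ₀mon T hT
    have h1 : Γ''.relIndex (Γ₀.map conj) ≠ 0 := fun h0 =>
      hΓ''fi.index_ne_zero (Subgroup.relIndex_eq_zero_of_le_right hmaple h0)
    have h2 : (Γ''.comap conj).relIndex Γ₀ ≠ 0 := by
      rwa [Subgroup.relIndex_comap]
    have h3 : Γ'.relIndex Γ₀ ≠ 0 := by
      change (Γ₀ ⊓ Γ''.comap conj).relIndex Γ₀ ≠ 0
      rwa [Subgroup.inf_relIndex_left]
    have h4 : Γ₀.relIndex (ratMonodromyGroup (familyM ℂ n d M) k hU ⟨AlgPoints.map ι c, mem_univ _⟩) ≠ 0 := hΓ₀fi.index_ne_zero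
    refine ⟨?_⟩
    change Γ'.relIndex _ ≠ 0
    rw [← Subgroup.relIndex_mul_relIndex Γ' Γ₀ (ratMonodromyGroup (familyM ℂ n d M) k hU ⟨AlgPoints.map ι c, mem_univ _⟩)
      inf_le_left hΓ₀le]
    exact mul_ne_zero h3 h4
  have hHS' : (A' c).hodgeStructure (hf'.isSmoothProjective c) (hA' c) k =
      ((A (AlgPoints.map ι c)).hodgeStructure (hu.isSmoothProjective (AlgPoints.map ι c)) (hA (AlgPoints.map ι c)) k).comapEquiv E := by
    rw [HodgeModel.hodgeStructure_eq_hodge exists_isReal_hodgeModel_holds hodgePQ_independent_of_hodgeModel_holds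
        (hf'.isSmoothProjective c) (A' c) (hA' c) k,
      HodgeModel.hodgeStructure_eq_hodge exists_isReal_hodgeModel_holds hodgePQ_independent_of_hodgeModel_holds
        (hu.isSmoothProjective (AlgPoints.map ι c)) (A (AlgPoints.map ι c)) (hA (AlgPoints.map ι c)) k]
    exact hodge_eq_comapEquiv_of_iso exists_isReal_hodgeModel_holds hodgePQ_independent_of_hodgeModel_holds
      (hf'.isSmoothProjective c) (hu.isSmoothProjective (AlgPoints.map ι c)) eC k
  have hΓ'MT : Γ' ≤ ((A (AlgPoints.map ι c)).hodgeStructure (hu.isSmoothProjective (AlgPoints.map ι c))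
      (hA (AlgPoints.map ι c)) k).mumfordTateGroup := by
    intro T hT
    have h1 := hΓ''MT (Subgroup.mem_inf.1 hT).2
    change conj T ∈ ((A' c).hodgeStructure (hf'.isSmoothProjective c) (hA' c) k).mumfordTateGroup at h1
    rw [hconj, hHS', HodgeStructure.mem_mumfordTateGroup_comapEquiv_iff] at h1
    have hid : E.symm.trans ((E.trans (T.trans E.symm)).trans E) = T := by
      ext v
      simp
    rwa [hid] at h1
  -- ### `(Γ^Zar)⁰ ⊆ (Γ')^Zar ⊆ MT`
  exact (glIdentityComponent_subset_of_finiteIndex hΓ'le hΓ'fi).trans (glZariskiClosure_subset_mumfordTateGroup _ hΓ'MT)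

end MonomialPencil

end Literature.AlgebraicGeometry.HodgeTheory

end
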